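import Summits.Schanuel.Schanuel.Theorems.RootDecomp1KGeneric20

/-!
# RootDecomp1K — lens 6, generation 14: the LOG-SQUARE CARVING (LogSq.lean v3 efa85398…) — continuation (RootDecomp1KGeneric21): §5 hypothesis-free tightness: Liouville's own numbers are NOT log-square Liouville (`not_logSqLiouville_liouvilleNumber`), barrier placement of (ℓ_b, ℓ_b²)

(lens-6 g14 `LogSq.lean` v3, sha256 efa85398…, 1497 l, farm rc 0 · 0 warn · 0 sorry; port by census-1 gen 12 in five parts
RootDecomp1KGeneric17–21 at the section cuts named in CENSUS-REQUEST 2026-08-30T23:30:45Z; each part imports the previous;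
everything mod the cited fact `NesterenkoWaldschmidt1996_thm_1` where marked, otherwise hypothesis-free; `--supports stmt-Schanuel-31077`.)
-/

set_option linter.unusedSectionVars false

noncomputable section

open Complex Polynomial

namespace Summit.Schanuel.Schanuel.Theorems.RootDecomp1KGeneric

open Summit.Schanuel.Schanuel.Theorems.RootDecomp1KHyper
open Summit.Schanuel.Schanuel.Theorems.RootDecomp1KHyper.HyperCell
open Literature.NumberTheory.Transcendental (NesterenkoWaldschmidt1996_thm_1 weilHeight₁)

variable {K : ℕ}

/-- `1 ≤ log x` for `x ≥ 3`. -/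
private theorem one_le_log_of_three_le {x : ℝ} (hx : 3 ≤ x) : 1 ≤ Real.log x := by
  rw [Real.le_log_iff_exp_le (by linarith)]
  have := Real.exp_one_lt_d9
  linarith

/-! ## §5  Tightness: Liouville's own numbers are NOT log-square Liouville (barrier placement) -/

/-- The first term bounds the remainder of a Liouville series from below. -/
private theorem le_remainder' {m : ℝ} (hm : 1 < m) (k : ℕ) :
    1 / m ^ (k + 1).factorial ≤ LiouvilleNumber.remainder m k := by
  have h := (LiouvilleNumber.remainder_summable hm k).le_tsum 0 (fun j _ => by positivity)
  simp only [zero_add] at h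
  exact h

/-- `(k + 1)(k + 2) ≤ 6 · k!` for `k ≥ 1`. -/
private theorem succ_mul_succ_succ_le_six_factorial {k : ℕ} (hk : 1 ≤ k) :
    (k + 1) * (k + 2) ≤ 6 * k.factorial := by
  induction k, hk using Nat.le_induction with
  | base => decide
  | succ n hn ih =>
    rw [Nat.factorial_succ]
    have h0 : n + 1 + 2 ≤ (n + 1) * (n + 1) := by nlinarith
    calc (n + 1 + 1) * (n + 1 + 2) ≤ (n + 1 + 1) * ((n + 1) * (n + 1)) := Nat.mul_le_mul_left _ h0
      _ = (n + 1) * ((n + 1) * (n + 2)) := by ring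
      _ ≤ (n + 1) * (6 * n.factorial) := Nat.mul_le_mul_left _ ih
      _ = 6 * ((n + 1) * n.factorial) := by ring

set_option maxHeartbeats 800000 in
/-- **Effective irrationality measure of `ℓ_b = liouvilleNumber b` at the log-square scale**:
`|ℓ_b − p/q| ≥ exp(−10 (log q)²)` for `q ≥ max(b, 3)`.  (With `b^{k!} ≤ q < b^{(k+1)!}`: either
`p/q` is the partial sum `P_{k+1}` and the distance is the remainder `≥ b^{−(k+2)!} ≥ q^{−(k+1)(k+2)}`,
or `|p/q − P_{k+1}| ≥ 1/(q b^{(k+1)!}) ≥ q^{−(k+2)}` while the remainder is half that; and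
`(k+1)(k+2) ≤ 6·k! ≤ 9 log q`.) -/
theorem liouvilleNumber_sub_rat_lower_logsq {b : ℕ} (hb : 2 ≤ b) (r : ℚ) (hq : b ≤ r.den)
    (hq3' : 3 ≤ r.den) :
    Real.exp (-(10 * Real.log r.den ^ 2)) ≤ |liouvilleNumber b - r| := by
  classical
  set q : ℕ := r.den with hqdef
  have hq2 : 2 ≤ q := hb.trans hq
  have hq1R : (1 : ℝ) ≤ q := by exact_mod_cast (show 1 ≤ q by omega)
  have hq0R : (0 : ℝ) < q := by linarith
  have hq3R : (3 : ℝ) ≤ q := by exact_mod_cast hq3'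
  have hb1 : 1 < b := by omega
  have hbR1 : (1 : ℝ) < b := by exact_mod_cast hb1
  have hbR2 : (2 : ℝ) ≤ b := by exact_mod_cast hb
  have hbR0 : (0 : ℝ) < b := by linarith
  set L : ℝ := Real.log q with hLdef
  have hL1 : 1 ≤ L := one_le_log_of_three_le hq3R
  have hL2 : 1 ≤ L ^ 2 := by nlinarith
  have hqpow : ∀ n : ℕ, (q : ℝ) ^ n = Real.exp ((n : ℝ) * L) := fun n => by
    rw [Real.exp_nat_mul, hLdef, Real.exp_log hq0R]
  -- `k ≥ 1` with `b^{k!} ≤ q < b^{(k+1)!}`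
  have hex : ∃ j : ℕ, q < b ^ (j + 1).factorial :=
    ⟨q, (Nat.lt_pow_self hb1).trans_le
      (Nat.pow_le_pow_right (by omega) ((Nat.self_le_factorial _).trans
        (Nat.factorial_le (Nat.le_succ q))))⟩
  set k : ℕ := Nat.find hex with hk
  have hkP : q < b ^ (k + 1).factorial := Nat.find_spec hex
  have hk1 : 1 ≤ k := by
    by_contra h0
    have h00 : k = 0 := by omega
    rw [h00] at hkP
    simp at hkP
    omega
  have hklow : b ^ k.factorial ≤ q := by
    have h := Nat.find_min hex (m := k - 1) (by omega)
    rw [Nat.sub_add_cancel hk1] at h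
    exact not_lt.mp h
  -- `k! ≤ (3/2) log q`, hence `(k+1)(k+2) log q ≤ 9 (log q)²`
  have hfact : ((k.factorial : ℕ) : ℝ) ≤ 3 / 2 * L := by
    have h1 : (b : ℝ) ^ k.factorial ≤ q := by exact_mod_cast hklow
    have h2 : (k.factorial : ℝ) * Real.log b ≤ L := by
      rw [← Real.log_pow]; exact Real.log_le_log (by positivity) h1
    have h3 : Real.log 2 ≤ Real.log b := Real.log_le_log (by norm_num) hbR2
    have h4 := Real.log_two_gt_d9
    have h5 : (0 : ℝ) ≤ k.factorial := Nat.cast_nonneg _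
    have h6 : (k.factorial : ℝ) * Real.log 2 ≤ (k.factorial : ℝ) * Real.log b :=
      mul_le_mul_of_nonneg_left h3 h5
    nlinarith
  have hE1 : (((k + 1) * (k + 2) : ℕ) : ℝ) * L ≤ 9 * L ^ 2 := by
    have h1 : (((k + 1) * (k + 2) : ℕ) : ℝ) ≤ 6 * (k.factorial : ℝ) := by
      exact_mod_cast succ_mul_succ_succ_le_six_factorial hk1
    have h0 : (0 : ℝ) ≤ L := by linarith
    nlinarith
  have hE2 : ((k + 2 : ℕ) : ℝ) * L ≤ 9 * L ^ 2 := by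
    have h1 : ((k + 2 : ℕ) : ℝ) ≤ (((k + 1) * (k + 2) : ℕ) : ℝ) := by
      exact_mod_cast (show k + 2 ≤ (k + 1) * (k + 2) by nlinarith)
    have h0 : (0 : ℝ) ≤ L := by linarith
    nlinarith
  -- real quantities
  set D : ℝ := (b : ℝ) ^ (k + 1).factorial with hD
  have hD0 : 0 < D := by positivity
  have hqD : (q : ℝ) < D := by rw [hD]; exact_mod_cast hkP
  have hqD' : (q : ℝ) ≤ D := hqD.le
  have hDq : D ≤ (q : ℝ) ^ (k + 1) := by
    have e : D = ((b : ℝ) ^ k.factorial) ^ (k + 1) := by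
      rw [hD, ← pow_mul, Nat.factorial_succ, Nat.mul_comm]
    rw [e]
    exact pow_le_pow_left₀ (by positivity) (by exact_mod_cast hklow) _
  have hD' : (b : ℝ) ^ (k + 2).factorial = D ^ (k + 2) := by
    rw [hD, ← pow_mul, show k + 2 = (k + 1) + 1 by omega, Nat.factorial_succ (k + 1),
      Nat.mul_comm]
  -- the partial sum `P = p / D` and the remainder `R`
  obtain ⟨p, hp⟩ := LiouvilleNumber.partialSum_eq_rat (by omega : 0 < b) (k + 1)
  rw [Nat.cast_pow] at hp
  set P : ℝ := LiouvilleNumber.partialSum b (k + 1) with hPdef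
  set R : ℝ := LiouvilleNumber.remainder b (k + 1) with hRdef
  have hℓ : liouvilleNumber b = P + R :=
    (LiouvilleNumber.partialSum_add_remainder hbR1 (k + 1)).symm
  have hRpos : 0 < R := LiouvilleNumber.remainder_pos hbR1 (k + 1)
  have hRlt : R < 1 / (q * D) / 2 := by
    have h1 := LiouvilleNumber.remainder_lt' (k + 1) hbR1
    have h2 : (1 - 1 / (b : ℝ))⁻¹ * (1 / (b : ℝ) ^ (k + 1 + 1).factorial) ≤ 2 * (1 / D ^ (k + 2)) := by
      rw [show k + 1 + 1 = k + 2 by omega, hD']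
      gcongr
      exact sub_one_div_inv_le_two hbR2
    have hD4 : (4 : ℝ) ≤ D := by
      have h2' : 2 ≤ (k + 1).factorial := (show 2 ≤ k + 1 by omega).trans (Nat.self_le_factorial _)
      calc (4 : ℝ) = 2 ^ 2 := by norm_num
        _ ≤ (b : ℝ) ^ 2 := pow_le_pow_left₀ (by norm_num) hbR2 2
        _ ≤ (b : ℝ) ^ (k + 1).factorial := pow_le_pow_right₀ hbR1.le h2'
    have h3 : 2 * (1 / D ^ (k + 2)) ≤ 2 * (1 / D ^ 3) := by
      gcongr
      · exact le_trans (by norm_num) hD4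
      · omega
    have h4 : 2 * (1 / D ^ 3) ≤ 1 / (q * D) / 2 := by
      rw [mul_one_div, div_div, div_le_div_iff₀ (by positivity) (by positivity), one_mul]
      have h5 : (q : ℝ) * D ≤ D * D := mul_le_mul_of_nonneg_right hqD' hD0.le
      have h6 : 4 * (D * D) ≤ D * (D * D) := mul_le_mul_of_nonneg_right hD4 (by positivity)
      nlinarith
    linarith
  have hRge : 1 / D ^ (k + 2) ≤ R := by
    rw [← hD', hRdef, show k + 2 = (k + 1) + 1 by omega]
    exact le_remainder' hbR1 (k + 1)
  have hhalf : Real.exp (-(10 * L ^ 2)) ≤ Real.exp (-(9 * L ^ 2)) / 2 := by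
    have h2 : (2 : ℝ) ≤ Real.exp (L ^ 2) := by linarith [Real.add_one_le_exp (L ^ 2)]
    rw [le_div_iff₀ (by norm_num : (0 : ℝ) < 2)]
    calc Real.exp (-(10 * L ^ 2)) * 2 ≤ Real.exp (-(10 * L ^ 2)) * Real.exp (L ^ 2) :=
          mul_le_mul_of_nonneg_left h2 (Real.exp_pos _).le
      _ = Real.exp (-(9 * L ^ 2)) := by rw [← Real.exp_add]; congr 1; ring
  by_cases hrP : (r : ℝ) = P
  · -- `r` IS the partial sum: the distance is the remainder `≥ D^{−(k+2)} ≥ q^{−(k+1)(k+2)}`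
    rw [hℓ, hrP, add_sub_cancel_left, abs_of_pos hRpos]
    refine le_trans ?_ hRge
    have h1 : 1 / (q : ℝ) ^ ((k + 1) * (k + 2)) ≤ 1 / D ^ (k + 2) := by
      apply one_div_le_one_div_of_le (by positivity)
      calc D ^ (k + 2) ≤ ((q : ℝ) ^ (k + 1)) ^ (k + 2) := pow_le_pow_left₀ hD0.le hDq _
        _ = (q : ℝ) ^ ((k + 1) * (k + 2)) := by rw [← pow_mul]
    refine le_trans ?_ h1
    rw [hqpow, one_div, ← Real.exp_neg, Real.exp_le_exp, neg_le_neg_iff]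
    nlinarith [hE1]
  · -- `r ≠ P`: `|r − P| ≥ 1/(qD)` (a non-zero integer over `qD`), and `R < 1/(2qD)`
    set N : ℤ := r.num * (b : ℤ) ^ (k + 1).factorial - (p : ℤ) * q with hN
    have hrq : (r : ℝ) = (r.num : ℝ) / q := by rw [hqdef]; exact_mod_cast r.num_div_den.symm
    have hdiff : (r : ℝ) - P = (N : ℝ) / (q * D) := by
      rw [hrq, hp, hN, hD]
      push_cast
      field_simp
    have hN0 : N ≠ 0 := by
      intro h0
      apply hrP
      have : (r : ℝ) - P = 0 := by rw [hdiff, h0]; simp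
      linarith
    have hN1 : (1 : ℝ) ≤ |(N : ℝ)| := by exact_mod_cast Int.one_le_abs hN0
    have hsep : 1 / (q * D) ≤ |(r : ℝ) - P| := by
      rw [hdiff, abs_div, abs_of_pos (by positivity : (0 : ℝ) < q * D)]
      exact div_le_div_of_nonneg_right hN1 (by positivity)
    -- `|ℓ − r| ≥ |r − P| − R ≥ 1/(2qD) ≥ 1/(2 q^{k+2})`
    have htri : |(r : ℝ) - P| - R ≤ |liouvilleNumber b - r| := by
      rw [hℓ]
      have e : P + R - (r : ℝ) = R - ((r : ℝ) - P) := by ring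
      rw [e, abs_sub_comm R ((r : ℝ) - P)]
      have h1 := abs_sub_abs_le_abs_sub ((r : ℝ) - P) R
      rw [abs_of_pos hRpos] at h1
      exact h1
    refine le_trans ?_ htri
    have hqD2 : 1 / (q : ℝ) ^ (k + 2) / 2 ≤ 1 / (q * D) / 2 := by
      have h1 : (q : ℝ) * D ≤ (q : ℝ) ^ (k + 2) := by
        rw [pow_succ']; exact mul_le_mul_of_nonneg_left hDq hq0R.le
      have h2 : 1 / (q : ℝ) ^ (k + 2) ≤ 1 / (q * D) := one_div_le_one_div_of_le (by positivity) h1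
      linarith
    have hmain : Real.exp (-(10 * L ^ 2)) ≤ 1 / (q : ℝ) ^ (k + 2) / 2 := by
      refine hhalf.trans ?_
      gcongr
      rw [hqpow, one_div, ← Real.exp_neg, Real.exp_le_exp, neg_le_neg_iff]
      linarith [hE2]
    linarith

/-- **P5 — Liouville's numbers are NOT log-square Liouville** (`b ≥ 2`; hypothesis-free).  So the
named open cell `(ℓ_b, ℓ_b²)` of the lineage lies OUTSIDE the g14 cell: exactly on the far side of
NW96's product-form wall. -/
theorem not_logSqLiouville_liouvilleNumber {b : ℕ} (hb : 2 ≤ b) :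
    ¬ LogSqLiouville (liouvilleNumber b) := by
  intro hH
  obtain ⟨r, hden, -, hlt⟩ := hH (b + 10)
  have hqb : b ≤ r.den := by omega
  have hq3 : 3 ≤ r.den := by omega
  have hlow := liouvilleNumber_sub_rat_lower_logsq hb r hqb hq3
  have h1 : Real.exp (-(((b + 10 : ℕ) : ℝ) * Real.log r.den ^ 2)) ≤
      Real.exp (-(10 * Real.log r.den ^ 2)) := by
    rw [Real.exp_le_exp, neg_le_neg_iff]
    refine mul_le_mul_of_nonneg_right ?_ (by positivity)
    push_cast; linarith [(Nat.cast_nonneg b : (0 : ℝ) ≤ b)]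
  linarith

/-- The three classes are nested and DISTINCT on the Liouville side:
hyper-Liouville ⊊? log-square Liouville ⊊ Liouville — `λ_H` is log-square Liouville, `ℓ_b` is
Liouville and not log-square Liouville (both hypothesis-free). -/
theorem logSq_classes_witnesses {b : ℕ} (hb : 2 ≤ b) :
    LogSqLiouville lambdaH ∧ Liouville (liouvilleNumber b) ∧ ¬ LogSqLiouville (liouvilleNumber b) :=
  ⟨logSqLiouville_lambdaH, liouville_liouvilleNumber hb, not_logSqLiouville_liouvilleNumber hb⟩

/-- **What remains open at the named cell.**  Schanuel's bound at `(ℓ_b, ℓ_b²)` would follow from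
`ℓ_b, e^{ℓ_b}` algebraically independent (Hyper16 `sb_liouvilleNumber_sq_of_algebraicIndependent`);
the g14 extraction cannot supply it: `ℓ_b` is not log-square Liouville (P5), i.e. its rational
approximations never beat NW96's `exp(−C (log q)²)`.  A measure with the heights entering as a SUM
(`(deg·h)^{−c}`, Lang–Waldschmidt shape) would; that is the catalogued wall (IDEA-NEEDED / BARRIER). -/
theorem liouvilleNumber_sq_open_cell_status {b : ℕ} (hb : 2 ≤ b) :
    ¬ LogSqLiouville (liouvilleNumber b) ∧
      (AlgebraicIndependent ℚ ![((liouvilleNumber b : ℝ) : ℂ), cexp (liouvilleNumber b : ℝ)] →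
        SB 2 ![((liouvilleNumber b : ℝ) : ℂ), ((liouvilleNumber b : ℝ) : ℂ) ^ 2]) :=
  ⟨not_logSqLiouville_liouvilleNumber hb, sb_liouvilleNumber_sq_of_algebraicIndependent⟩

end Summit.Schanuel.Schanuel.Theorems.RootDecomp1KGeneric
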